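import Literature.NumberTheory.EllipticCurves.GaloisActionProofs
import Literature.NumberTheory.EllipticCurves.Sha
import Literature.NumberTheory.GaloisRepresentations.LocalGlobalCohomology
import Literature.NumberTheory.GaloisRepresentations.ContinuousH1
import HarnessLib

/-!
# `E(K̄)` as a discrete Galois module: the bridge from `Sha.lean` to `GaloisRepresentations`

The Tate–Shafarevich group `WeierstrassCurve.sha` of `Literature/NumberTheory/EllipticCurves/Sha.lean`
(and `H¹(K, E) = WeierstrassCurve.galH1`, the local groups `WeierstrassCurve.localH1`, the Selmer
prelude) are built on the light-weight glue `Literature.NumberTheory.EllipticCurves.discreteTopRep /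
discreteH1` of `GaloisAction.lean` (a `DistribMulAction` of a topological group on a discrete
group, no continuity recorded), whereas the Galois-cohomological machinery of
`Literature/NumberTheory/GaloisRepresentations/` — restriction and inflation
(`galoisCohomology.res`, `.inf`), Kummer theory and Hilbert 90 (`GaloisCohomologyKummerProofs`),
cup products (`ContinuousCupProduct`), the Tate dual and the local Tate pairing
(`LocalGlobalCohomology`, `LocalTatePairing`), `DiscreteGaloisModule.sha` and Selmer structures —
is phrased for `Literature.NumberTheory.GaloisRepresentations.DiscreteGaloisModule K M`
(a *continuous* representation of `Γ_K` on a discrete module). The docstring of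
`GaloisRepresentations/GaloisCohomology.lean` asks for the two to be unified. This file does it
for the modules attached to a Weierstrass curve, with complete proofs and mostly *definitional*
identifications:

* `WeierstrassCurve.galoisModule W : DiscreteGaloisModule F (geomPoints W)` — `E(F̄)` with its
  `Γ_F`-action (continuity = openness of stabilisers, the discharged fact
  `isOpen_stabilizer_point_holds`, Silverman *AEC* App. B.2 / Serre II.§1); its `toTopRep` **is**
  `discreteTopRep Γ_F (geomPoints W)` and `galoisCohomology W.galoisModule 1` **is** `W.galH1`
  (`toTopRep_galoisModule`, `galoisCohomology_galoisModule_one`, both `rfl`), with the same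
  group structure.
* `WeierstrassCurve.localGaloisModule W E : DiscreteGaloisModule E (localPoints W E)` — the local
  coefficient module `E(K̄_E)` of `Sha.lean` (`isOpen_stabilizer_localPoints` proved here);
  `galoisCohomology (W.localGaloisModule E) 1 = W.localH1 E` (`rfl`).
* `WeierstrassCurve.torsionGaloisModule W n : DiscreteGaloisModule F (geomTorsion W n)` — `E[n]`,
  whose `H¹` is the `galH1Torsion W n` of the Selmer prelude (`rfl`); this is the finite module to
  which the local Tate duality fact `exists_perfectPairing_galoisCohomology_tateDual` applies.
* The two libraries make the *same* choices: `closureEmb E = absClosureEmbedding F E` and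
  `resGal E = absGaloisRestrict F E` (`rfl`).
* `WeierstrassCurve.localRestrictionHom_eq_map_comp_res`: the local restriction
  `loc_E : H¹(K, E(K̄)) → H¹(Γ_E, E(K̄_E))` of `Sha.lean` factors as the restriction
  `res_E : H¹(K, E(K̄)) → H¹(Γ_E, E(K̄))` of the `GaloisRepresentations` library followed by the
  change of coefficients along `pointsMap : E(K̄) → E(K̄_E)` (`pointsMapIntertwining`); proved on
  continuous crossed homomorphisms (`ContinuousH1.lean`: `oneCocycleClass_surjective`,
  `map_oneCocycleClass`).
* `WeierstrassCurve.sha_galoisModule_le_sha`: consequently `DiscreteGaloisModule.sha W.galoisModule ≤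
  W.sha` — a class of `H¹(K, E)` that dies in `H¹(Γ_{K_v}, E(K̄))` for every place `v` dies in
  `H¹(Γ_{K_v}, E(K̄_v))`.

What is NOT formal (and not claimed): the reverse inclusion `W.sha ≤ W.galoisModule.sha`. The
group `H¹(Γ_{K_v}, E(K̄))` (with `Γ_{K_v}` acting through `Γ_{K_v} → Γ_K`, i.e. `H¹` over the
decomposition field, the algebraic closure of `K` in `K_v`) maps isomorphically to
`H¹(Γ_{K_v}, E(K̄_v))`, but this is Greenberg's approximation theorem for torsors (Milne,
*Arithmetic Duality Theorems*, I, Remark 3.10(a)(ii), p. 47, and its proof), not homological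
algebra. For the *finite* modules `E[n]` there is no such issue: all `n`-torsion of `E(K̄_v)` comes
from `E(K̄)` (`Literature.NumberTheory.EllipticCurves.exists_pointsMapOfEmb_eq_of_nsmul_eq_zero`,
file `NeronOggShafarevichLocal`).

Motivation (provefact `WeierstrassCurve.exists_casselsTate_pairing`, Silverman *AEC* X.4.14): the
Cassels–Tate pairing on `W.sha` is defined (Milne, *ADT*, I, Prop. 6.9, p. 78) from lifts to
`H¹(K, E[m])`, local Tate duality for the finite modules `E[m]` and `E[m²]`, cup products and the
invariant maps of local class field theory — all of which live, as far as the tree has them, on the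
`DiscreteGaloisModule` side. No named fact is introduced here (D-0026).

## References

* [SerreGaloisCohomology1997] J.-P. Serre, *Galois Cohomology*, Springer 1997: I.§2.2 (cochains),
  I.§2.4 (compatible pairs, restriction), II.§1.1 (discrete `Γ_K`-modules, `H¹(K, A)`).
* [SilvermanAEC2009] J. H. Silverman, *The Arithmetic of Elliptic Curves*, 2nd ed., GTM 106,
  Springer 2009: VIII.§1–2, X.§4 (`H¹(G_{K̄/K}, E)`, `Ш(E/K)`), App. B.2 (continuous action),
  Thm. X.4.14.
* [MilneADT2006] J. S. Milne, *Arithmetic Duality Theorems*, 2nd ed. (2006): I, Remark 3.10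
  (henselian versus complete), I.§6, Prop. 6.9 and Thm. 6.13 (the pairing on `Ш`).
-/

noncomputable section

open scoped Classical

universe u

namespace WeierstrassCurve

open Literature.NumberTheory.EllipticCurves Literature.NumberTheory.GaloisRepresentations Field
open NumberField IsDedekindDomain

variable {F : Type u} [Field F] (W : WeierstrassCurve F)

/-! ## `E(F̄)` as a discrete Galois module -/

/-- The `ℤ`-linear representation of `Γ_F = Gal(F̄/F)` on `E(F̄) = geomPoints W` underlying the
Galois action on points (`σ ↦ (P ↦ σ • P)` as a `ℤ`-linear map). Deliberate dot-notation extension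
of Mathlib's `WeierstrassCurve` namespace (as throughout `GaloisAction.lean`).
Silverman, *AEC*, VIII.§1; Serre, *Galois Cohomology*, II.§1.1. [folklore] -/
def galoisRepresentation : Representation ℤ (absoluteGaloisGroup F) (geomPoints W) where
  toFun σ := (DistribSMul.toAddMonoidHom (geomPoints W) σ).toIntLinearMap
  map_one' := by ext P; simp
  map_mul' σ τ := by ext P; simp [mul_smul]

/-- Unfolding `galoisRepresentation`: `ρ σ P = σ • P`. [folklore] -/
@[simp]
theorem galoisRepresentation_apply_apply (σ : absoluteGaloisGroup F) (P : geomPoints W) :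
    W.galoisRepresentation σ P = σ • P :=
  rfl

/-- **`E(F̄)` as a discrete Galois module** over `F`
(`Literature.NumberTheory.GaloisRepresentations.DiscreteGaloisModule`): the representation
`galoisRepresentation` is continuous for the Krull topology on `Γ_F` and the discrete topology on
`E(F̄)` because every stabiliser is open (`isOpen_stabilizer_point_holds`, Silverman *AEC* App. B.2;
`DiscreteGaloisModule.ofIsOpenStabilizer`). Serre, *Galois Cohomology*, II.§1.1 ("`A(k_s)` is a
discrete `Gal(k_s/k)`-module"); Silverman, *AEC*, VIII.§1 and App. B.2.
[cite: SerreGaloisCohomology1997, II.§1.1] -/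
def galoisModule : DiscreteGaloisModule F (geomPoints W) :=
  DiscreteGaloisModule.ofIsOpenStabilizer W.galoisRepresentation fun P => by
    have h := isOpen_stabilizer_point_holds W P
    convert h using 2
    ext σ
    simp only [Set.mem_setOf_eq, galoisRepresentation_apply_apply, SetLike.mem_coe,
      MulAction.mem_stabilizer_iff]

/-- Unfolding `galoisModule`: `ρ σ P = σ • P`. [folklore] -/
@[simp]
theorem galoisModule_apply_apply (σ : absoluteGaloisGroup F) (P : geomPoints W) :
    W.galoisModule σ P = σ • P :=
  rfl

/-- The underlying representation of `galoisModule` is `galoisRepresentation`. [folklore] -/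
@[simp]
theorem galoisModule_toRepresentation :
    W.galoisModule.toRepresentation = W.galoisRepresentation :=
  rfl

/-- The object of `TopRep ℤ Γ_F` underlying `galoisModule` **is** the `discreteTopRep` of
`GaloisAction.lean` (definitionally). [folklore] -/
theorem toTopRep_galoisModule :
    W.galoisModule.toTopRep = discreteTopRep (absoluteGaloisGroup F) (geomPoints W) :=
  rfl

/-- `Hⁿ(F, E(F̄))` in the sense of the `GaloisRepresentations` library is Mathlib's
`continuousCohomology n` of the `discreteTopRep` of `GaloisAction.lean` (definitionally).
Serre, *Galois Cohomology*, II.§1.1. [folklore] -/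
theorem galoisCohomology_galoisModule (n : ℕ) :
    galoisCohomology W.galoisModule n =
      ↑(continuousCohomology n (discreteTopRep (absoluteGaloisGroup F) (geomPoints W))) :=
  rfl

/-- **`H¹(F, E)` is the same group in both libraries**: `galoisCohomology W.galoisModule 1` is
`W.galH1` (definitionally, including the group structure: see the `example` below).
Serre, *Galois Cohomology*, II.§1.1; Silverman, *AEC*, X.§4. [folklore] -/
theorem galoisCohomology_galoisModule_one : galoisCohomology W.galoisModule 1 = W.galH1 :=
  rfl

/-- The two `AddCommGroup` structures on `H¹(F, E)` agree definitionally. -/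
example : (galoisCohomology.instAddCommGroup W.galoisModule 1 : AddCommGroup W.galH1) =
    (inferInstance : AddCommGroup W.galH1) :=
  rfl

/-! ## `E[n]` as a (finite) discrete Galois module -/

/-- The stabiliser in `Γ_F` of an `n`-torsion point is open (it is the stabiliser of the underlying
point of `E(F̄)`). Silverman, *AEC*, III.§7 and App. B.2. [folklore] -/
theorem isOpen_stabilizer_geomTorsion (n : ℤ) (P : geomTorsion W n) :
    IsOpen ((MulAction.stabilizer (absoluteGaloisGroup F) P : Subgroup _) :
      Set (absoluteGaloisGroup F)) := by
  have h := isOpen_stabilizer_point_holds W (P : geomPoints W)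
  convert h using 2
  ext σ
  simp only [MulAction.mem_stabilizer_iff, Subtype.ext_iff,
    Literature.NumberTheory.EllipticCurves.AddSubgroup.torsionBy.coe_smul]

/-- The `ℤ`-linear representation of `Γ_F` on `E[n] = geomTorsion W n` (the restricted action
`Literature.NumberTheory.EllipticCurves.AddSubgroup.torsionBy.instDistribMulAction`).
Silverman, *AEC*, III.§7. [folklore] -/
def torsionGaloisRepresentation (n : ℤ) :
    Representation ℤ (absoluteGaloisGroup F) (geomTorsion W n) where
  toFun σ := (DistribSMul.toAddMonoidHom (geomTorsion W n) σ).toIntLinearMap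
  map_one' := by ext P; simp
  map_mul' σ τ := by ext P; simp [mul_smul]

/-- Unfolding `torsionGaloisRepresentation`: `ρ σ P = σ • P`. [folklore] -/
@[simp]
theorem torsionGaloisRepresentation_apply_apply (n : ℤ) (σ : absoluteGaloisGroup F)
    (P : geomTorsion W n) : W.torsionGaloisRepresentation n σ P = σ • P :=
  rfl

/-- **`E[n]` as a discrete Galois module** over `F` (finite for `W` elliptic and `n ≠ 0`,
`finite_torsionPoints_holds`). This is the module `ρ` at which the local Tate duality fact
`Literature.NumberTheory.GaloisRepresentations.exists_perfectPairing_galoisCohomology_tateDual` is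
to be instantiated. Serre, *Galois Cohomology*, II.§1.1; Silverman, *AEC*, III.§7, VIII.§2, X.§4.
[cite: SerreGaloisCohomology1997, II.§1.1] -/
def torsionGaloisModule (n : ℤ) : DiscreteGaloisModule F (geomTorsion W n) :=
  DiscreteGaloisModule.ofIsOpenStabilizer (W.torsionGaloisRepresentation n) fun P => by
    have h := W.isOpen_stabilizer_geomTorsion n P
    convert h using 2
    ext σ
    simp only [Set.mem_setOf_eq, torsionGaloisRepresentation_apply_apply, SetLike.mem_coe,
      MulAction.mem_stabilizer_iff]

/-- Unfolding `torsionGaloisModule`: `ρ σ P = σ • P`. [folklore] -/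
@[simp]
theorem torsionGaloisModule_apply_apply (n : ℤ) (σ : absoluteGaloisGroup F)
    (P : geomTorsion W n) : W.torsionGaloisModule n σ P = σ • P :=
  rfl

/-- The `TopRep` underlying `torsionGaloisModule` is the `discreteTopRep` of `E[n]`
(definitionally). [folklore] -/
theorem toTopRep_torsionGaloisModule (n : ℤ) :
    (W.torsionGaloisModule n).toTopRep =
      discreteTopRep (absoluteGaloisGroup F) (geomTorsion W n) :=
  rfl

/-- `Hᵏ(F, E[n])` of the `GaloisRepresentations` library is Mathlib's `continuousCohomology k` of
`discreteTopRep Γ_F E[n]`; for `k = 1` this is the type `WeierstrassCurve.galH1Torsion W n` of the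
Selmer prelude (`Selmer.lean`), definitionally. Silverman, *AEC*, X.§4. [folklore] -/
theorem galoisCohomology_torsionGaloisModule (n : ℤ) (k : ℕ) :
    galoisCohomology (W.torsionGaloisModule n) k =
      ↑(continuousCohomology k (discreteTopRep (absoluteGaloisGroup F) (geomTorsion W n))) :=
  rfl

/-- In degree one: `galoisCohomology (W.torsionGaloisModule n) 1 = discreteH1 Γ_F E[n]`
(`= W.galH1Torsion n`), definitionally. [folklore] -/
theorem galoisCohomology_torsionGaloisModule_one (n : ℤ) :
    galoisCohomology (W.torsionGaloisModule n) 1 =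
      discreteH1 (absoluteGaloisGroup F) (geomTorsion W n) :=
  rfl

/-! ## The two libraries make the same choices of embeddings and restrictions -/

variable (E : Type u) [Field E] [Algebra F E]

/-- The chosen embedding `F̄ → Ē` of `Sha.lean` (`closureEmb`) is the chosen embedding of
`AbsGaloisGroup.lean` (`absClosureEmbedding`): both are `IsAlgClosed.lift` (definitionally).
[folklore] -/
theorem closureEmb_eq_absClosureEmbedding :
    closureEmb (K := F) E = absClosureEmbedding F E :=
  rfl

/-- The restriction `Γ_E → Γ_F` of `Sha.lean` (`resGal`) is the restriction `absGaloisRestrict` of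
`AbsGaloisGroup.lean` (definitionally: both are `restrictNormalHom ∘ restrictScalars` for the chosen
embedding). Serre, *Galois Cohomology*, II.§1.1. [folklore] -/
theorem resGal_eq_absGaloisRestrict : resGal (K := F) E = absGaloisRestrict F E :=
  rfl

/-! ## The local module `E(K̄_E)` -/

/-- The stabiliser in `Γ_E` of a point of `E(K̄_E)` (`localPoints W E`, with `Γ_E` acting through
`restrictScalars`) is open: it contains `Gal(K̄_E/E(x, y))` for `P = (x, y)`. Same proof as
`isOpen_stabilizer_point_holds`. Serre, *Galois Cohomology*, II.§1.1; Silverman, *AEC*, App. B.2.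
[cite: SerreGaloisCohomology1997, II.§1.1] -/
theorem isOpen_stabilizer_localPoints (P : localPoints W E) :
    IsOpen ((MulAction.stabilizer (absoluteGaloisGroup E) P : Subgroup _) :
      Set (absoluteGaloisGroup E)) := by
  change (W.baseChange (AlgebraicClosure E)).toAffine.Point at P
  rcases P with (_ | ⟨x, y, h⟩)
  · convert isOpen_univ
    ext σ
    simp only [SetLike.mem_coe, MulAction.mem_stabilizer_iff, Set.mem_univ, iff_true]
    exact smul_zero σ
  · let L : IntermediateField E (AlgebraicClosure E) := IntermediateField.adjoin E {x, y}
    haveI : FiniteDimensional E L :=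
      IntermediateField.finiteDimensional_adjoin fun z _ => Algebra.IsIntegral.isIntegral z
    apply Subgroup.isOpen_mono (H₁ := L.fixingSubgroup) ?_ L.fixingSubgroup_isOpen
    intro σ hσ
    rw [IntermediateField.mem_fixingSubgroup_iff] at hσ
    have hx : σ x = x := hσ x (IntermediateField.subset_adjoin E _ (by simp))
    have hy : σ y = y := hσ y (IntermediateField.subset_adjoin E _ (by simp))
    change Affine.Point.map
      ((AlgEquiv.restrictScalars F (show AlgebraicClosure E ≃ₐ[E] AlgebraicClosure E from σ) :
          AlgebraicClosure E ≃ₐ[F] AlgebraicClosure E) :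
        AlgebraicClosure E →ₐ[F] AlgebraicClosure E) (.some x y h) = Affine.Point.some x y h
    rw [Affine.Point.map_some]
    congr 1

/-- The `ℤ`-linear representation of `Γ_E` on `E(K̄_E) = localPoints W E` underlying the Galois
action of `Sha.lean`. Silverman, *AEC*, X.§4; Serre, *Galois Cohomology*, II.§1.1. [folklore] -/
def localGaloisRepresentation :
    Representation ℤ (absoluteGaloisGroup E) (localPoints W E) where
  toFun σ := (DistribSMul.toAddMonoidHom (localPoints W E) σ).toIntLinearMap
  map_one' := by ext P; simp
  map_mul' σ τ := by ext P; simp [mul_smul]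

/-- Unfolding `localGaloisRepresentation`: `ρ σ P = σ • P`. [folklore] -/
@[simp]
theorem localGaloisRepresentation_apply_apply (σ : absoluteGaloisGroup E) (P : localPoints W E) :
    W.localGaloisRepresentation E σ P = σ • P :=
  rfl

/-- **`E(K̄_E)` as a discrete Galois module** over the `F`-field `E` (a completion `K_v`): the
local coefficient module of `Sha.lean`, continuous by `isOpen_stabilizer_localPoints`.
Serre, *Galois Cohomology*, II.§1.1; Silverman, *AEC*, X.§4; Milne, *ADT*, I.§6.
[cite: SerreGaloisCohomology1997, II.§1.1] -/
def localGaloisModule : DiscreteGaloisModule E (localPoints W E) :=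
  DiscreteGaloisModule.ofIsOpenStabilizer (W.localGaloisRepresentation E) fun P => by
    have h := W.isOpen_stabilizer_localPoints E P
    convert h using 2
    ext σ
    simp only [Set.mem_setOf_eq, localGaloisRepresentation_apply_apply, SetLike.mem_coe,
      MulAction.mem_stabilizer_iff]

/-- Unfolding `localGaloisModule`: `ρ σ P = σ • P`. [folklore] -/
@[simp]
theorem localGaloisModule_apply_apply (σ : absoluteGaloisGroup E) (P : localPoints W E) :
    W.localGaloisModule E σ P = σ • P :=
  rfl

/-- The `TopRep` underlying `localGaloisModule` is the `discreteTopRep` of `localPoints W E`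
(definitionally). [folklore] -/
theorem toTopRep_localGaloisModule :
    (W.localGaloisModule E).toTopRep = discreteTopRep (absoluteGaloisGroup E) (localPoints W E) :=
  rfl

/-- **`H¹(E, E(K̄_E))` is the same group in both libraries**:
`galoisCohomology (W.localGaloisModule E) 1 = W.localH1 E`, definitionally.
Silverman, *AEC*, X.§4. [folklore] -/
theorem galoisCohomology_localGaloisModule_one :
    galoisCohomology (W.localGaloisModule E) 1 = W.localH1 E :=
  rfl

/-! ## The local restriction of `Sha.lean` factors through `res` -/

open scoped ContRepresentation

/-- The map on points `E(K̄) → E(K̄_E)` (`pointsMap`, induced by the chosen embedding) as a continuous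
intertwining map from the restricted module `E(K̄)|_{Γ_E}` (`GaloisRep.restrictField E W.galoisModule`,
i.e. `Γ_E` acting through `absGaloisRestrict F E = resGal E`) to `E(K̄_E)`; equivariance is
`pointsMap_smul`. Serre, *Galois Cohomology*, I.§2.4 (compatible pairs). [folklore] -/
def pointsMapIntertwining :
    (GaloisRep.restrictField E W.galoisModule).toContRepresentation →ⁱL
      (W.localGaloisModule E).toContRepresentation where
  toContinuousLinearMap := ⟨(pointsMap W E).toIntLinearMap, continuous_of_discreteTopology⟩
  isIntertwining' σ := by
    ext P
    exact pointsMap_smul W E σ P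

/-- Unfolding `pointsMapIntertwining`. [folklore] -/
@[simp]
theorem pointsMapIntertwining_apply (P : geomPoints W) :
    W.pointsMapIntertwining E P = pointsMap W E P :=
  rfl

/-- The restriction `res_E : H¹(F, E(F̄)) → H¹(Γ_E, E(F̄))` of the `GaloisRepresentations` library
on classes of continuous crossed homomorphisms: `[φ] ↦ [φ ∘ res]` (`map_oneCocycleClass`).
Serre, *Galois Cohomology*, I.§2.4 and I.§5.1. [folklore] -/
theorem res_galoisModule_oneCocycleClass
    (φ : contOneCocycles (discreteTopRep (absoluteGaloisGroup F) (geomPoints W))) :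
    galoisCohomology.res W.galoisModule E 1
        (oneCocycleClass (discreteTopRep (absoluteGaloisGroup F) (geomPoints W)) φ) =
      oneCocycleClass (DiscreteGaloisModule.toTopRep (GaloisRep.restrictField E W.galoisModule))
        (contOneCocycles.pullback (absGaloisRestrict F E)
          (X := discreteTopRep (absoluteGaloisGroup F) (geomPoints W))
          (Y := DiscreteGaloisModule.toTopRep (GaloisRep.restrictField E W.galoisModule))
          (TopRep.ofHom ⟨ContinuousLinearMap.id ℤ (geomPoints W), fun _ => rfl⟩) φ) :=
  map_oneCocycleClass _ _ _ φ

/-- The change-of-coefficients map `(pointsMap)_* : H¹(Γ_E, E(F̄)) → H¹(Γ_E, E(K̄_E))` on classes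
of continuous crossed homomorphisms: `[ψ] ↦ [pointsMap ∘ ψ]`. Serre, *Galois Cohomology*, I.§2.4.
[folklore] -/
theorem map_pointsMapIntertwining_oneCocycleClass
    (ψ : contOneCocycles
      (DiscreteGaloisModule.toTopRep (GaloisRep.restrictField E W.galoisModule))) :
    galoisCohomology.map (W.pointsMapIntertwining E) 1 (oneCocycleClass _ ψ) =
      oneCocycleClass (discreteTopRep (absoluteGaloisGroup E) (localPoints W E))
        (contOneCocycles.pullback (ContinuousMonoidHom.id (absoluteGaloisGroup E))
          (X := DiscreteGaloisModule.toTopRep (GaloisRep.restrictField E W.galoisModule))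
          (Y := discreteTopRep (absoluteGaloisGroup E) (localPoints W E))
          (TopRep.ofHom ⟨(W.pointsMapIntertwining E).toContinuousLinearMap,
            (W.pointsMapIntertwining E).isIntertwining'⟩) ψ) :=
  map_oneCocycleClass _ _ _ ψ

/-- The local restriction `loc_E` of `Sha.lean` (`localRestrictionHom`) on classes of continuous
crossed homomorphisms: `[φ] ↦ [pointsMap ∘ φ ∘ resGal]`. Serre, *Galois Cohomology*, I.§2.4;
Silverman, *AEC*, X.§4. [folklore] -/
theorem localRestrictionHom_oneCocycleClass
    (φ : contOneCocycles (discreteTopRep (absoluteGaloisGroup F) (geomPoints W))) :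
    W.localRestrictionHom E
        (oneCocycleClass (discreteTopRep (absoluteGaloisGroup F) (geomPoints W)) φ) =
      oneCocycleClass (discreteTopRep (absoluteGaloisGroup E) (localPoints W E))
        (contOneCocycles.pullback (resGal (K := F) E)
          (resHomOfEquivariant (resGal (K := F) E) (pointsMap W E) (pointsMap_smul W E)) φ) :=
  map_oneCocycleClass _ _ _ φ

/-- **`loc_E c = (pointsMap)_* (res_E c)`** for every `c ∈ H¹(F, E)`: the local restriction of
`Sha.lean` is the restriction of the `GaloisRepresentations` library followed by the change of
coefficients `E(F̄) → E(K̄_E)`. (Every class is the class of a continuous crossed homomorphism,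
`oneCocycleClass_surjective`, and both sides send `[φ]` to `[pointsMap ∘ φ ∘ res]`.)
Serre, *Galois Cohomology*, I.§2.4; Silverman, *AEC*, X.§4. [folklore] -/
theorem localRestrictionHom_apply_eq_map_res (c : W.galH1) :
    W.localRestrictionHom E c =
      galoisCohomology.map (W.pointsMapIntertwining E) 1
        (galoisCohomology.res W.galoisModule E 1 c) := by
  obtain ⟨φ, rfl⟩ :=
    oneCocycleClass_surjective (discreteTopRep (absoluteGaloisGroup F) (geomPoints W)) c
  rw [localRestrictionHom_oneCocycleClass, res_galoisModule_oneCocycleClass,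
    map_pointsMapIntertwining_oneCocycleClass]
  rfl

/-- **`loc_E = (pointsMap)_* ∘ res_E`** as homomorphisms `H¹(F, E) → H¹(E, E(K̄_E))`.
Serre, *Galois Cohomology*, I.§2.4; Silverman, *AEC*, X.§4. [folklore] -/
theorem localRestrictionHom_eq_map_comp_res :
    W.localRestrictionHom E =
      (galoisCohomology.map (W.pointsMapIntertwining E) 1).comp
        (galoisCohomology.res W.galoisModule E 1) :=
  AddMonoidHom.ext fun c => W.localRestrictionHom_apply_eq_map_res E c

/-! ## `Ш` of the discrete Galois module `E(K̄)` versus `Ш(E/K)` -/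

section NumberField

variable [NumberField F]

/-- At a finite place, the localisation map of `LocalGlobalCohomology.lean` for `E(F̄)` is `res` to
`v.adicCompletion F` (definitionally, by cases on `NumberField.Place`). [folklore] -/
theorem localization_galoisModule_inr (v : HeightOneSpectrum (𝓞 F)) (n : ℕ) :
    galoisCohomology.localization W.galoisModule (Sum.inr v) n =
      galoisCohomology.res W.galoisModule (v.adicCompletion F) n :=
  rfl

/-- At an infinite place, the localisation map of `LocalGlobalCohomology.lean` for `E(F̄)` is `res`
to `w.Completion` (definitionally). [folklore] -/
theorem localization_galoisModule_inl (w : InfinitePlace F) (n : ℕ) :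
    galoisCohomology.localization W.galoisModule (Sum.inl w) n =
      galoisCohomology.res W.galoisModule w.Completion n :=
  rfl

/-- **`Ш(F, E(F̄)) ≤ Ш(E/F)`.** The Tate–Shafarevich group of the discrete Galois module `E(F̄)` in
the sense of `LocalGlobalCohomology.lean` (`DiscreteGaloisModule.sha`: classes of
`H¹(F, E) = galoisCohomology W.galoisModule 1 = W.galH1` restricting to zero in `H¹(Γ_{F_v}, E(F̄))`
for every place `v`) is contained in `Ш(E/F) = W.sha` of `Sha.lean` (classes dying in
`H¹(Γ_{F_v}, E(F̄_v))`), because `loc_v = (pointsMap)_* ∘ res_v`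
(`localRestrictionHom_eq_map_comp_res`). The reverse inclusion is Greenberg's approximation theorem
(Milne, *ADT*, I, Remark 3.10(a)(ii)) and is not proved here.
[cite: MilneADT2006, I Remark 3.10] -/
theorem sha_galoisModule_le_sha : W.galoisModule.sha ≤ W.sha := by
  intro c hc
  rw [DiscreteGaloisModule.mem_sha_iff] at hc
  have key := (W.mem_sha_iff c).mpr ⟨fun v => ?_, fun w => ?_⟩
  · exact key
  · refine (W.mem_localRestrictionKer_iff _ c).mpr ?_
    have h0 : galoisCohomology.res W.galoisModule (v.adicCompletion F) 1 c = 0 := hc (Sum.inr v)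
    rw [localRestrictionHom_apply_eq_map_res, h0, map_zero]
    rfl
  · refine (W.mem_localRestrictionKer_iff _ c).mpr ?_
    have h0 : galoisCohomology.res W.galoisModule w.Completion 1 c = 0 := hc (Sum.inl w)
    rw [localRestrictionHom_apply_eq_map_res, h0, map_zero]
    rfl

end NumberField

end WeierstrassCurve

end
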